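import Literature.NumberTheory.PAdicHodge.BdRPlusFormalLogTheta
import Literature.NumberTheory.PAdicHodge.KummerCocycleMatching
import Literature.NumberTheory.PAdicHodge.CompletedAlgClosureAlgClosed
import Literature.NumberTheory.EllipticCurves.PointDivisibilityProofs
import Literature.NumberTheory.EllipticCurves.FormalGroupChartLimitLogSurjectiveProofs
import HarnessLib

/-!
# The image of `θ` on Fontaine's integrating elements: every small `c ∈ ℂ_F` is `θ(log_W(ι[ũ]) mod Fil^k)` (good supersingular reduction)

Topic `Literature/NumberTheory/PAdicHodge`; namespace `Literature.NumberTheory.PAdicHodge.GaloisContinuity`. THEOREMS ONLY (no definition, no instance,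
no named fact, no `sorry`). The IMAGE half of the fundamental exact sequence of the «`X_W` road» (memo
`Summits/…/Cruxes/StarredOptimalManinUnitFiveSeven/Lines/kato-lever-K3-H4-log.md` §3b (iii), `…-K3-H4-theta.md` §3 (iv)), complementing
`BdRPlusFormalLogTheta` (`θ(L) = log_ω(P(u₀))`) and `BdRPlusFormalLogThetaKernel` (the kernel): for `W/ℤ` with GOOD SUPERSINGULAR reduction at `p ≠ 2`
(`p ∤ Δ`, Hasse invariant `0` — the three supersingular cells of K★), every `c ∈ ℂ_F` with `‖c‖ ≤ ‖p‖²` is the `θ`-value of a value `L` of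
`log_W(ι[ũ])` modulo `Fil^k` for some `[p]`-division sequence `u` in `Ŵ(𝔪_{ℂ_F})` with `‖u₀‖ ≤ ‖p‖²`; hence `θ(X_W) ⊇ p²𝒪_{ℂ_F}` and `ℚ_p·θ(X_W) = ℂ_F`.

* `exists_mem_kernel_zCoord_eq` — every `a` with `‖a‖ < 1` is the parameter of a point of `E₁(K)` (`P(a)`, AEC VII.2.2), any complete ultrametric `K`;
  `exists_limit_of_geometric` — geometric Cauchy sequences converge with the sharp ultrametric tail bound;
* ★ `exists_mem_kernel_limitLog_eq` — **`ℓ_p` is onto `p²𝒪_K` from `{Q ∈ E₁(K) : ‖z(Q)‖ ≤ ‖p‖²}`** (tree `exists_limitLog_eq_of_val_le` with both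
  side conditions discharged), any complete ultrametric `K` of characteristic `0` with `‖p‖ < 1`;
* ★ `exists_divSeq_mem_kernel` — at good supersingular `p ≠ 2`, **every `Q ∈ E₁(ℂ_F)` has a `p`-power division sequence inside `E₁(ℂ_F)`**
  (`E(ℂ_F)` is divisible, `ℂ_F` being algebraically closed — tree `nsmul_surjective_of_isAlgClosed`, `CompletedAlgClosure.isAlgClosed` —, and
  `pⁿR ∈ E₁ ⟹ R ∈ E₁` as the reduction has no `p`-torsion, tree `AinfTop.mem_kernel_of_pow_smul_mem_kernel`); `mulPC_zPt_of_nsmul_eq` — its parameters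
  form a `[p]_W`-division sequence in `Ŵ(𝔪_{ℂ_F})`;
* ★★ `exists_isFormalLogModFil_thetaBdR_eq` — **IMAGE**: for `‖c‖ ≤ ‖p‖²` and every `k ≥ 1` there are a `[p]`-division sequence `u` (`‖u₀‖ ≤ ‖p‖`) and a
  value `L` of `log_W(ι[ũ])` modulo `Fil^k` with `θ(L) = c`; `exists_isFormalLogModFil_thetaBdR_eq_pow_mul` — for every `c ∈ ℂ_F` some `p^N c` is such
  a `θ`-value.

Crux K★ `stmt-BirchSwinnertonDyer-22226`, floor (H4) step (3). Infrastructure only; BSD / K★ are not proved by any of this.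

## References
* J.-M. Fontaine, *Formes différentielles et modules de Tate…*, Invent. Math. 65 (1982), §5. [Fontaine1982FormesDifferentielles]
* J. H. Silverman, *The Arithmetic of Elliptic Curves* (2009), Thm. IV.6.4 (b), Prop. VII.2.1–VII.2.2, VIII.§2. [SilvermanAEC2009]
* J.-P. Serre, *Local class field theory*, in Cassels–Fröhlich (1967), Ch. VI §3.2. [CasselsFrohlichANT1967]
-/

noncomputable section

namespace Literature.NumberTheory.PAdicHodge

namespace GaloisContinuity

open scoped NNReal Classical
open ValuativeRel Field Ideal WittVector Filter
open _root_.Topology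
open Literature.NumberTheory.GaloisRepresentations Literature.NumberTheory.GaloisRepresentations.IsNonarchimedeanLocalField
open Literature.NumberTheory.GaloisRepresentations.LubinTate
open Literature.NumberTheory.EllipticCurves Literature.NumberTheory.EllipticCurves.FormalGroupChart

/-! ## §1 Over a complete ultrametric field: `ℓ_p` is onto `p²𝒪_K` -/

section Complete

variable {K : Type*} [NontriviallyNormedField K] [IsUltrametricDist K] [CompleteSpace K] [CharZero K] (W : WeierstrassCurve ℤ)
  [(curveOver K W).IsElliptic] {p : ℕ} [Fact p.Prime]

omit [Fact p.Prime] [CharZero K] in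
/-- **Every `a ∈ 𝔪_K` is the parameter of a point of `E₁(K)`**: `z(P(a)) = a` (AEC VII.2.2, tree `ptOfZ`). [cite: SilvermanAEC2009, Prop. VII.2.2] -/
theorem exists_mem_kernel_zCoord_eq {a : K} (ha : ‖a‖ < 1) :
    ∃ P ∈ kernel (NormedField.valuation (K := K)) (curveOver K W), P.zCoord = a :=
  ⟨ptOfZ K W (mkBallPt a ha), ptOfZ_mem_kernel _, by rw [zCoord_ptOfZ]; rfl⟩

omit [(curveOver K W).IsElliptic] [Fact p.Prime] [CharZero K] in
/-- **Geometric Cauchy sequences converge, with the ultrametric tail bound**: if `‖x_{k+1} − x_k‖ ≤ C θ^k`, `θ < 1`, then some `y` has `‖y − x_k‖ ≤ C θ^k` for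
all `k` (ultrametric telescoping; `K` complete). [cite: CasselsFrohlichANT1967, Ch. VI §3.2] -/
theorem exists_limit_of_geometric (x : ℕ → K) (C θ : ℝ≥0) (hθ : θ < 1)
    (hx : ∀ k, NormedField.valuation (x (k + 1) - x k) ≤ C * θ ^ k) : ∃ y : K, ∀ k, NormedField.valuation (y - x k) ≤ C * θ ^ k := by
  simp only [NormedField.valuation_apply] at hx ⊢
  have htail : ∀ k m, ‖x (k + m) - x k‖₊ ≤ C * θ ^ k := by
    intro k m
    induction m with
    | zero => simp
    | succ m ih =>
      have hstep : ‖x (k + m + 1) - x (k + m)‖₊ ≤ C * θ ^ k :=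
        (hx (k + m)).trans (mul_le_mul_of_nonneg_left (pow_le_pow_right_of_le_one' hθ.le (Nat.le_add_right k m)) zero_le)
      have e : x (k + (m + 1)) - x k = (x (k + m + 1) - x (k + m)) + (x (k + m) - x k) := by rw [← add_assoc]; ring
      rw [e]
      exact (IsUltrametricDist.nnnorm_add_le_max _ _).trans (max_le hstep ih)
  have hcauchy : CauchySeq x := by
    refine cauchySeq_of_le_geometric (θ : ℝ) (C : ℝ) (by exact_mod_cast hθ) fun n => ?_
    rw [dist_eq_norm, ← norm_neg, neg_sub]
    exact_mod_cast hx n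
  obtain ⟨y, hy⟩ := cauchySeq_tendsto_of_complete hcauchy
  refine ⟨y, fun k => ?_⟩
  have hlim : Tendsto (fun m => x (k + m) - x k) atTop (𝓝 (y - x k)) :=
    (hy.comp (tendsto_atTop_atTop_of_monotone (fun a b h => Nat.add_le_add_left h k) fun b => ⟨b, Nat.le_add_left b k⟩)).sub
      tendsto_const_nhds
  have hclosed : IsClosed {z : K | ‖z‖₊ ≤ C * θ ^ k} := isClosed_le continuous_nnnorm continuous_const
  exact hclosed.mem_of_tendsto hlim (Eventually.of_forall fun m => htail k m)

/-- ★ **`ℓ_p` is onto `p²𝒪_K` from `{Q ∈ E₁(K) : ‖z(Q)‖ ≤ ‖p‖²}`** over every complete ultrametric `K` of characteristic `0` with `‖p‖ < 1` (tree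
`exists_limitLog_eq_of_val_le`, AEC IV.6.4 (b) one level lower than sharp; side conditions: parameters lift by `P(a)`, geometric Cauchy sequences converge).
[cite: SilvermanAEC2009, Thm. IV.6.4 (b) with Prop. VII.2.2] -/
theorem exists_mem_kernel_limitLog_eq (hp1 : ‖(p : K)‖ < 1) {c : K} (hc : ‖c‖ ≤ ‖(p : K)‖ ^ 2) :
    ∃ Q ∈ kernel (NormedField.valuation (K := K)) (curveOver K W),
      ‖Q.zCoord‖ ≤ ‖(p : K)‖ ^ 2 ∧ limitLog (NormedField.valuation (K := K)) (curveOver K W) p Q = c := by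
  have hp0 : (p : K) ≠ 0 := Nat.cast_ne_zero.2 (Fact.out : p.Prime).ne_zero
  have hp1v : NormedField.valuation (p : K) < 1 := by
    rw [← NNReal.coe_lt_coe, NormedField.valuation_apply, coe_nnnorm]; exact hp1
  have hρ1 : NormedField.valuation (p : K) ^ 2 < 1 := pow_lt_one₀ zero_le hp1v two_ne_zero
  have hlift : ∀ a : K, NormedField.valuation a ≤ NormedField.valuation (p : K) ^ 2 →
      ∃ P ∈ kernel (NormedField.valuation (K := K)) (curveOver K W), P.zCoord = a := fun a ha =>
    exists_mem_kernel_zCoord_eq W (by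
      have h := ha.trans_lt hρ1
      rwa [← NNReal.coe_lt_coe, NormedField.valuation_apply, coe_nnnorm, NNReal.coe_one] at h)
  have hcv : NormedField.valuation c ≤ NormedField.valuation (p : K) ^ 2 := by
    rw [← NNReal.coe_le_coe, NNReal.coe_pow, NormedField.valuation_apply, NormedField.valuation_apply, coe_nnnorm, coe_nnnorm]; exact hc
  obtain ⟨Q, hQ, hQz, hQc⟩ := exists_limitLog_eq_of_val_le hp0 hp1v (limitLog_spec_of_completeSpace hp0 hp1v) le_rfl hlift
    (exists_limit_of_geometric (K := K)) hcv
  refine ⟨Q, hQ, ?_, hQc⟩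
  rwa [← NNReal.coe_le_coe, NNReal.coe_pow, NormedField.valuation_apply, NormedField.valuation_apply, coe_nnnorm, coe_nnnorm] at hQz

end Complete

/-! ## §2 Division sequences inside `E₁(ℂ_F)` at good supersingular reduction -/

section Supersingular

variable {F : Type} [Field F] [ValuativeRel F] [TopologicalSpace F] [IsNonarchimedeanLocalField F]
  [CharZero F] {p : ℕ} [Fact p.Prime] [Fact (¬ IsUnit (p : integerC F))]
  [IsAdicComplete (Ideal.span {(p : integerC F)}) (integerC F)]
  {hθ : Function.Surjective (fontaineTheta (integerC F) p)} (W : WeierstrassCurve ℤ) [(curveOver (CompletedAlgClosure F) W).IsElliptic]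

omit [Fact (¬ IsUnit (p : integerC F))] [IsAdicComplete (Ideal.span {(p : integerC F)}) (integerC F)] in
/-- ★ **Division sequences inside `E₁(ℂ_F)`.** For `W/ℤ` with good supersingular reduction at `p ≠ 2` (`p ∤ Δ`, Hasse invariant `0`) and `Q ∈ E₁(ℂ_F)` there is a
`p`-power division sequence `R` of `Q` (`R₀ = Q`, `p • R_{n+1} = R_n`) all of whose members lie in `E₁(ℂ_F)`: `E(ℂ_F)` is divisible (`ℂ_F` algebraically closed,
tree `nsmul_surjective_of_isAlgClosed`), and `pⁿ • R_n = Q ∈ E₁` forces `R_n ∈ E₁` (the reduction has no `p`-torsion, tree `AinfTop.mem_kernel_of_pow_smul_mem_kernel`).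
[cite: SilvermanAEC2009, VIII.§2 with Prop. VII.2.1–VII.2.2] -/
theorem exists_divSeq_mem_kernel (hp : valuation F p < 1) (hp2 : p ≠ 2) (hΔ : ¬ (p : ℤ) ∣ W.Δ)
    (hA : (W.map (Int.castRingHom (ZMod p))).hasseCoeff p = 0) {Q : (curveOver (CompletedAlgClosure F) W).toAffine.Point}
    (hQ : Q ∈ kernel (NormedField.valuation (K := CompletedAlgClosure F)) (curveOver (CompletedAlgClosure F) W)) :
    ∃ R : ℕ → (curveOver (CompletedAlgClosure F) W).toAffine.Point, R 0 = Q ∧ (∀ n, p • R (n + 1) = R n) ∧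
      ∀ n, R n ∈ kernel (NormedField.valuation (K := CompletedAlgClosure F)) (curveOver (CompletedAlgClosure F) W) := by
  haveI : IsAlgClosed (CompletedAlgClosure F) := CompletedAlgClosure.isAlgClosed (F := F)
  have hpC : ‖(p : CompletedAlgClosure F)‖ < 1 := norm_natCast_C_lt_one hp
  have hsurj := (curveOver (CompletedAlgClosure F) W).nsmul_surjective_of_isAlgClosed (n := p) (Fact.out : p.Prime).ne_zero
  let R : ℕ → (curveOver (CompletedAlgClosure F) W).toAffine.Point := fun n => Nat.rec Q (fun _ S => Classical.choose (hsurj S)) n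
  have hR0 : R 0 = Q := rfl
  have hRs : ∀ n, p • R (n + 1) = R n := fun n => Classical.choose_spec (hsurj (R n))
  refine ⟨R, hR0, hRs, fun n => AinfTop.mem_kernel_of_pow_smul_mem_kernel W hpC hp2 hΔ hA n ?_⟩
  rw [AinfTop.pow_smul_divSeq hRs n, hR0]
  exact hQ

omit [CharZero F] [Fact p.Prime] [Fact (¬ IsUnit (p : integerC F))] [IsAdicComplete (Ideal.span {(p : integerC F)}) (integerC F)] in
/-- **The parameters of a `p`-power division sequence inside `E₁(ℂ_F)` form a `[p]_W`-division sequence in `Ŵ(𝔪_{ℂ_F})`** (`z(p • R) = [p]_W z(R)`,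
AEC VII.2.2, tree `zPt_nsmul`). [cite: SilvermanAEC2009, Prop. VII.2.2] -/
theorem mulPC_zPt_of_nsmul_eq {R : ℕ → (curveOver (CompletedAlgClosure F) W).toAffine.Point} (hRs : ∀ n, p • R (n + 1) = R n)
    (hker : ∀ n, R n ∈ kernel (NormedField.valuation (K := CompletedAlgClosure F)) (curveOver (CompletedAlgClosure F) W)) (n : ℕ) :
    AinfTop.mulPC F p W (zPt (R (n + 1)) (hker (n + 1))) = zPt (R n) (hker n) := by
  have h := zPt_nsmul p (hker (n + 1))
  have e : zPt (p • R (n + 1)) ((kernel (NormedField.valuation (K := CompletedAlgClosure F)) (curveOver (CompletedAlgClosure F) W)).nsmul_mem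
      (hker (n + 1)) p) = zPt (R n) (hker n) := by
    refine Subtype.ext (Subtype.ext ?_)
    rw [coe_zPt, coe_zPt, hRs]
  rw [← e, h]
  rfl

/-! ## §3 The image of `θ` -/

/-- ★★ **IMAGE of `θ` on the values of `log_W(ι[ũ])`** (good supersingular `p ≠ 2`). For every `c ∈ ℂ_F` with `‖c‖ ≤ ‖p‖²` and every `k ≥ 1` there are a
`[p]`-division sequence `u` in `Ŵ(𝔪_{ℂ_F})` with `‖u₀‖ ≤ ‖p‖` and a value `L` of `log_W(ι[ũ])` modulo `Fil^k` with **`θ(L) = c`**: take `Q ∈ E₁(ℂ_F)` with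
`ℓ_p(Q) = c` (§1), a division sequence of `Q` inside `E₁(ℂ_F)` (§2), `uₙ = z(Rₙ)`, and any value `L` (existence, `exists_isFormalLogModFil`); then
`θ(L) = log_ω(P(u₀)) = log_ω(Q) = ℓ_p(Q) = c` (`thetaBdR_eq_padicLogPointFiniteExt_of_zCoord_eq`). [cite: Fontaine1982FormesDifferentielles, §5]
[cite: SilvermanAEC2009, Thm. IV.6.4 (b) with Prop. VII.2.2] -/
theorem exists_isFormalLogModFil_thetaBdR_eq (hp : valuation F p < 1) (hp2 : p ≠ 2) (hΔ : ¬ (p : ℤ) ∣ W.Δ)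
    (hA : (W.map (Int.castRingHom (ZMod p))).hasseCoeff p = 0) {k : ℕ} (hk : 1 ≤ k) {c : CompletedAlgClosure F}
    (hc : ‖c‖ ≤ ‖(p : CompletedAlgClosure F)‖ ^ 2) :
    ∃ (u : ℕ → (maxNilIdealC F).toIdeal) (hup : ∀ n, AinfTop.mulPC F p W (u (n + 1)) = u n),
      ‖(((u 0 : (maxNilIdealC F).toIdeal) : CBall F) : CompletedAlgClosure F)‖ ≤ ‖(p : CompletedAlgClosure F)‖ ∧
      ∃ L : BDeRhamPlus (integerC F) p, IsFormalLogModFil W k ((AinfTop.of F p).symm (AinfTop.torsionLift W hθ u hup)) L ∧ thetaBdR L = c := by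
  haveI : CharZero (CompletedAlgClosure F) := charZero_of_injective_algebraMap (algebraMap F _).injective
  have hpC : ‖(p : CompletedAlgClosure F)‖ < 1 := norm_natCast_C_lt_one hp
  have hp0C : (p : CompletedAlgClosure F) ≠ 0 := Nat.cast_ne_zero.2 (Fact.out : p.Prime).ne_zero
  have hpCv : NormedField.valuation (p : CompletedAlgClosure F) < 1 := by
    rw [← NNReal.coe_lt_coe, NormedField.valuation_apply, coe_nnnorm]; exact hpC
  have hpp : ‖(p : CompletedAlgClosure F)‖ ^ 2 ≤ ‖(p : CompletedAlgClosure F)‖ := by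
    rw [sq]; exact mul_le_of_le_one_left (norm_nonneg _) hpC.le
  -- the point `Q` with `ℓ_p(Q) = c`, a division sequence inside `E₁(ℂ_F)`, and its parameters
  obtain ⟨Q, hQ, hQz, hQc⟩ := exists_mem_kernel_limitLog_eq W (K := CompletedAlgClosure F) hpC hc
  obtain ⟨R, hR0, hRs, hker⟩ := exists_divSeq_mem_kernel W hp hp2 hΔ hA hQ
  set u : ℕ → (maxNilIdealC F).toIdeal := fun n => zPt (R n) (hker n) with hu
  have hup : ∀ n, AinfTop.mulPC F p W (u (n + 1)) = u n := mulPC_zPt_of_nsmul_eq W hRs hker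
  have hu0 : (((u 0 : (maxNilIdealC F).toIdeal) : CBall F) : CompletedAlgClosure F) = Q.zCoord := by
    show ((((zPt (R 0) (hker 0)) : (ballNilIdeal (CompletedAlgClosure F)).toIdeal) : unitBall (CompletedAlgClosure F)) :
      CompletedAlgClosure F) = Q.zCoord
    rw [coe_zPt, hR0]
  have hu0p : ‖(((u 0 : (maxNilIdealC F).toIdeal) : CBall F) : CompletedAlgClosure F)‖ ≤ ‖(p : CompletedAlgClosure F)‖ := by
    rw [hu0]; exact hQz.trans hpp
  -- a value and its `θ`
  have hI := (torsionLift_mem_span_p_xi_iff (hθ := hθ) W u hup).2 hu0p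
  obtain ⟨L, hL⟩ := exists_isFormalLogModFil W hI k
  refine ⟨u, hup, hu0p, L, hL, ?_⟩
  have hQlev : Q ∈ level (NormedField.valuation (K := CompletedAlgClosure F)) (curveOver (CompletedAlgClosure F) W)
      (NormedField.valuation (p : CompletedAlgClosure F)) := by
    refine ⟨hQ, ?_⟩
    rw [← NNReal.coe_le_coe, NormedField.valuation_apply, NormedField.valuation_apply, coe_nnnorm, coe_nnnorm]; exact hQz.trans hpp
  rw [hL.thetaBdR_eq_padicLogPointFiniteExt_of_zCoord_eq hp W hk hup hQ hu0.symm (hQz.trans hpp),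
    padicLogPointFiniteExt_eq_limitLog hp0C hpCv (limitLog_spec_of_completeSpace hp0C hpCv) hQlev, hQc]

/-- **Every `c ∈ ℂ_F` is, up to a power of `p`, a `θ`-value**: `∃ N u L, IsFormalLogModFil W k [ũ] L ∧ θ(L) = p^N c` (scale `c` into the ball `‖·‖ ≤ ‖p‖²`).
So `ℚ_p · θ(X_W) = ℂ_F`. [cite: Fontaine1982FormesDifferentielles, §5] [cite: SilvermanAEC2009, Thm. IV.6.4 (b)] -/
theorem exists_isFormalLogModFil_thetaBdR_eq_pow_mul (hp : valuation F p < 1) (hp2 : p ≠ 2) (hΔ : ¬ (p : ℤ) ∣ W.Δ)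
    (hA : (W.map (Int.castRingHom (ZMod p))).hasseCoeff p = 0) {k : ℕ} (hk : 1 ≤ k) (c : CompletedAlgClosure F) :
    ∃ (N : ℕ) (u : ℕ → (maxNilIdealC F).toIdeal) (hup : ∀ n, AinfTop.mulPC F p W (u (n + 1)) = u n),
      ‖(((u 0 : (maxNilIdealC F).toIdeal) : CBall F) : CompletedAlgClosure F)‖ ≤ ‖(p : CompletedAlgClosure F)‖ ∧
      ∃ L : BDeRhamPlus (integerC F) p, IsFormalLogModFil W k ((AinfTop.of F p).symm (AinfTop.torsionLift W hθ u hup)) L ∧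
        thetaBdR L = (p : CompletedAlgClosure F) ^ N * c := by
  haveI : CharZero (CompletedAlgClosure F) := charZero_of_injective_algebraMap (algebraMap F _).injective
  have hpC : ‖(p : CompletedAlgClosure F)‖ < 1 := norm_natCast_C_lt_one hp
  have hp0C : (p : CompletedAlgClosure F) ≠ 0 := Nat.cast_ne_zero.2 (Fact.out : p.Prime).ne_zero
  have hpos : 0 < ‖(p : CompletedAlgClosure F)‖ := norm_pos_iff.2 hp0C
  -- choose `N` with `‖p‖^N ‖c‖ ≤ ‖p‖^2`
  obtain ⟨M, hM⟩ : ∃ M : ℕ, ‖(p : CompletedAlgClosure F)‖ ^ M * ‖c‖ ≤ 1 := by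
    have h := (tendsto_pow_atTop_nhds_zero_of_lt_one (norm_nonneg _) hpC).mul_const ‖c‖
    rw [zero_mul] at h
    exact (h.eventually (eventually_le_nhds zero_lt_one)).exists
  refine ⟨M + 2, ?_⟩
  have hc : ‖(p : CompletedAlgClosure F) ^ (M + 2) * c‖ ≤ ‖(p : CompletedAlgClosure F)‖ ^ 2 :=
    calc ‖(p : CompletedAlgClosure F) ^ (M + 2) * c‖ = ‖(p : CompletedAlgClosure F)‖ ^ 2 * (‖(p : CompletedAlgClosure F)‖ ^ M * ‖c‖) := by
          rw [norm_mul, norm_pow, pow_add]; ring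
      _ ≤ ‖(p : CompletedAlgClosure F)‖ ^ 2 * 1 := mul_le_mul_of_nonneg_left hM (by positivity)
      _ = _ := mul_one _
  obtain ⟨u, hup, hu, L, hL, hθL⟩ := exists_isFormalLogModFil_thetaBdR_eq W (hθ := hθ) hp hp2 hΔ hA hk hc
  exact ⟨u, hup, hu, L, hL, hθL⟩

end Supersingular

end GaloisContinuity

end Literature.NumberTheory.PAdicHodge

end
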